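import Mathlib
import HarnessLib
import Summits.HubbardSuperconductivity.HubbardSuperconductivity.Theorems.KLProgrammeKLRegimeCountertermJacksonKernelDerivs

/-!
# Route `KLProgramme`, crux K3 — `L¹` bounds for the derivatives of the `2π`-periodic Jackson kernel, part 2: the bounds (MS-A34-ter (K1))

Seat hubbard-kl-k3c3-p1 (g4).  Part 1 (`…JacksonKernelDerivs`) set up `Φ = F_d(·/2π)` with its derivatives `Φ₁…Φ₄` as finite trigonometric sums and the
iterated-derivative family `jkerD d a = deriv^[a] J̃_d` of the kernel `J̃_d = Φ²/(2π·c)` with the closed forms of orders `≤ 3`.  Here: Bessel-type bounds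
`∫(Σ a_h cos(h s))² ≤ 2πΣa_h²` (and the sine twin), `Σ_{h≤d}(f_h hʳ)² ≤ 4(d+1)^{2r+1}`, hence `∫Φ_r² ≤ 8π(d+1)^{2r+1}`; the weighted AM–GM
`|xy| ≤ (t x² + y²/t)/2`; and with `c ≥ 8(d+1)/π⁴` (`jacksonConst_ge`):

  `∫|J̃_d| = 1`,  `∫|J̃_d′| ≤ π⁴(d+1)`,  `∫|J̃_d″| ≤ 2π⁴(d+1)²`,  `∫|J̃_d‴| ≤ 4π⁴(d+1)³`;  uniformly `∫|J̃_d^{(a)}| ≤ 4π⁴(d+1)^a` (`a ≤ 3`),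
  products `≤ 16π⁸(d+1)^{a+b}` — the `Λ` of `norm_iteratedFDeriv_convInt_le` (`…JacksonMixedBernstein`).

Pure real analysis; nothing about the model.
-/

noncomputable section

namespace Summit.HubbardSuperconductivity.HubbardSuperconductivity.Theorems.KLRegimeSplit

set_option linter.dupNamespace false -- summit = problem name (single-conjunct summit), D-0017

open Real Finset MeasureTheory intervalIntegral Literature.Analysis.Fourier.TrigApprox

/-! ## §4 Square integrals of the trigonometric sums -/

/-- `∫_{−π}^{π} sin(m s) sin(k s) ds = [m = k ≠ 0]·π`. -/
theorem integral_sin_mul_sin (m k : ℕ) :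
    ∫ s in (-π)..π, Real.sin (m * s) * Real.sin (k * s) = if m = k then (if k = 0 then 0 else π) else 0 := by
  have hprod : ∀ s : ℝ, Real.sin (m * s) * Real.sin (k * s) =
      (Real.cos (((m : ℝ) - k) * s) - Real.cos (((m : ℝ) + k) * s)) / 2 := by
    intro s
    rw [show ((m : ℝ) + k) * s = m * s + k * s by ring, show ((m : ℝ) - k) * s = m * s - k * s by ring,
      Real.cos_add, Real.cos_sub]
    ring
  simp_rw [hprod]
  rw [intervalIntegral.integral_div, intervalIntegral.integral_sub (Continuous.intervalIntegrable (by fun_prop) _ _)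
    (Continuous.intervalIntegrable (by fun_prop) _ _)]
  by_cases hmk : m = k
  · subst hmk
    rw [if_pos rfl]
    have h2 : ∫ s in (-π)..π, Real.cos (((m : ℝ) - m) * s) = 2 * π := by simp; ring
    rw [h2]
    by_cases hm : m = 0
    · subst hm; simp; ring
    · have h1 : ∫ s in (-π)..π, Real.cos (((m : ℝ) + m) * s) = 0 :=
        integral_cos_intMul ((m : ℤ) + m) (by push_cast; ring) (by positivity)
      rw [h1, if_neg hm]; ring
  · rw [if_neg hmk]
    have hne : (m : ℝ) - k ≠ 0 := fun h => hmk (by exact_mod_cast (sub_eq_zero.mp h))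
    have hne' : (m : ℝ) + k ≠ 0 := by
      intro h
      have : (m : ℝ) = 0 ∧ (k : ℝ) = 0 := by
        constructor <;> linarith [(Nat.cast_nonneg m : (0:ℝ) ≤ m), (Nat.cast_nonneg k : (0:ℝ) ≤ k)]
      exact hmk (by exact_mod_cast this.1.trans this.2.symm)
    rw [integral_cos_intMul ((m : ℤ) + k) (by push_cast; ring) hne', integral_cos_intMul ((m : ℤ) - k) (by push_cast; ring) hne]
    simp

/-- **Bessel-type bound for a finite cosine sum**: `∫ (Σ a_h cos(h s))² ≤ 2π Σ a_h²`. -/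
theorem integral_sq_cosSum_le (n : ℕ) (a : ℕ → ℝ) :
    ∫ s in (-π)..π, (∑ h ∈ range n, a h * Real.cos (h * s)) ^ 2 ≤ 2 * π * ∑ h ∈ range n, a h ^ 2 := by
  have hexp : ∀ s, (∑ h ∈ range n, a h * Real.cos (h * s)) ^ 2 =
      ∑ h ∈ range n, ∑ k ∈ range n, a h * a k * (Real.cos (h * s) * Real.cos (k * s)) := by
    intro s; rw [sq, Finset.sum_mul_sum]; refine Finset.sum_congr rfl fun h _ => Finset.sum_congr rfl fun k _ => by ring
  simp_rw [hexp]
  rw [intervalIntegral.integral_finsetSum fun h _ => ?_]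
  · have hin : ∀ h ∈ range n, ∫ s in (-π)..π, ∑ k ∈ range n, a h * a k * (Real.cos (h * s) * Real.cos (k * s)) = a h ^ 2 * cosNorm h := by
      intro h hh
      rw [intervalIntegral.integral_finsetSum fun k _ => (Continuous.intervalIntegrable (by fun_prop) _ _)]
      simp_rw [intervalIntegral.integral_const_mul, integral_cos_mul_cos]
      simp [sq, Finset.mem_range.mp hh]
    rw [Finset.sum_congr rfl hin, Finset.mul_sum]
    exact Finset.sum_le_sum fun h _ => by
      have := cosNorm_le h; have := sq_nonneg (a h); nlinarith
  · exact Continuous.intervalIntegrable (by fun_prop) _ _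

/-- **Bessel-type bound for a finite sine sum**: `∫ (Σ a_h sin(h s))² ≤ 2π Σ a_h²`. -/
theorem integral_sq_sinSum_le (n : ℕ) (a : ℕ → ℝ) :
    ∫ s in (-π)..π, (∑ h ∈ range n, a h * Real.sin (h * s)) ^ 2 ≤ 2 * π * ∑ h ∈ range n, a h ^ 2 := by
  have hexp : ∀ s, (∑ h ∈ range n, a h * Real.sin (h * s)) ^ 2 =
      ∑ h ∈ range n, ∑ k ∈ range n, a h * a k * (Real.sin (h * s) * Real.sin (k * s)) := by
    intro s; rw [sq, Finset.sum_mul_sum]; refine Finset.sum_congr rfl fun h _ => Finset.sum_congr rfl fun k _ => by ring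
  simp_rw [hexp]
  rw [intervalIntegral.integral_finsetSum fun h _ => ?_]
  · have hin : ∀ h ∈ range n, ∫ s in (-π)..π, ∑ k ∈ range n, a h * a k * (Real.sin (h * s) * Real.sin (k * s)) =
        a h ^ 2 * (if h = 0 then 0 else π) := by
      intro h hh
      rw [intervalIntegral.integral_finsetSum fun k _ => (Continuous.intervalIntegrable (by fun_prop) _ _)]
      simp_rw [intervalIntegral.integral_const_mul, integral_sin_mul_sin]
      simp [sq, Finset.mem_range.mp hh]
    rw [Finset.sum_congr rfl hin, Finset.mul_sum]
    exact Finset.sum_le_sum fun h _ => by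
      have := sq_nonneg (a h); have := Real.pi_pos
      split_ifs <;> nlinarith
  · exact Continuous.intervalIntegrable (by fun_prop) _ _

/-- `|f_h| ≤ 2` for `h ≤ d`. -/
theorem abs_fejerCoeff_le (d : ℕ) {h : ℕ} (hh : h ≤ d) : |fejerCoeff d h| ≤ 2 := by
  unfold fejerCoeff
  split_ifs with h0
  · norm_num
  · have hd : (0 : ℝ) < d + 1 := by positivity
    have hh' : (h : ℝ) ≤ d := by exact_mod_cast hh
    have h1 : (1 : ℝ) ≤ h := by exact_mod_cast Nat.one_le_iff_ne_zero.mpr h0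
    rw [abs_le]; constructor
    · rw [le_div_iff₀ hd]; nlinarith
    · rw [div_le_iff₀ hd]; nlinarith

/-- `Σ_{h ≤ d} (f_h h^r)² ≤ 4(d+1)^{2r+1}`. -/
theorem sum_sq_fejerCoeff_mul_pow_le (d r : ℕ) :
    ∑ h ∈ range (d + 1), (fejerCoeff d h * (h : ℝ) ^ r) ^ 2 ≤ 4 * ((d : ℝ) + 1) ^ (2 * r + 1) := by
  calc ∑ h ∈ range (d + 1), (fejerCoeff d h * (h : ℝ) ^ r) ^ 2 ≤ ∑ _h ∈ range (d + 1), 4 * ((d : ℝ) + 1) ^ (2 * r) :=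
        Finset.sum_le_sum fun h hh => by
          have h1 : |fejerCoeff d h| ≤ 2 := abs_fejerCoeff_le d (by have := mem_range.mp hh; omega)
          have h2 : (h : ℝ) ≤ d + 1 := by have := mem_range.mp hh; exact_mod_cast (by omega : h ≤ d + 1)
          have h3 : (h : ℝ) ^ r ≤ ((d : ℝ) + 1) ^ r := pow_le_pow_left₀ (by positivity) h2 r
          have h4 : fejerCoeff d h ^ 2 ≤ 4 := by nlinarith [abs_nonneg (fejerCoeff d h), sq_abs (fejerCoeff d h)]
          have h5 : ((h : ℝ) ^ r) ^ 2 ≤ (((d : ℝ) + 1) ^ r) ^ 2 := pow_le_pow_left₀ (by positivity) h3 2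
          calc (fejerCoeff d h * (h : ℝ) ^ r) ^ 2 = fejerCoeff d h ^ 2 * ((h : ℝ) ^ r) ^ 2 := by ring
            _ ≤ 4 * (((d : ℝ) + 1) ^ r) ^ 2 := mul_le_mul h4 h5 (by positivity) (by norm_num)
            _ = 4 * ((d : ℝ) + 1) ^ (2 * r) := by rw [← pow_mul, mul_comm r 2]
    _ = 4 * ((d : ℝ) + 1) ^ (2 * r + 1) := by rw [Finset.sum_const, Finset.card_range, nsmul_eq_mul, pow_succ]; push_cast; ring

/-- `∫Φ² ≤ 8π(d+1)`. -/
theorem integral_sq_fejerP_le (d : ℕ) : ∫ s in (-π)..π, fejerP d s ^ 2 ≤ 8 * π * ((d : ℝ) + 1) := by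
  have h := integral_sq_cosSum_le (d + 1) (fun h => fejerCoeff d h)
  simp_rw [← fejerP_eq] at h
  have h2 := sum_sq_fejerCoeff_mul_pow_le d 0
  simp only [pow_zero, mul_one, mul_zero, zero_add, pow_one] at h2
  nlinarith [Real.pi_pos]

/-- `∫Φ₁² ≤ 8π(d+1)³`. -/
theorem integral_sq_fejerP1_le (d : ℕ) : ∫ s in (-π)..π, fejerP1 d s ^ 2 ≤ 8 * π * ((d : ℝ) + 1) ^ 3 := by
  have h := integral_sq_sinSum_le (d + 1) (fun h => fejerCoeff d h * (-(h : ℝ)))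
  have hf : ∀ s, ∑ h ∈ range (d + 1), fejerCoeff d h * (-(h : ℝ)) * Real.sin (h * s) = fejerP1 d s := fun s => by
    unfold fejerP1; exact Finset.sum_congr rfl fun h _ => by ring
  simp_rw [hf] at h
  have h2 := sum_sq_fejerCoeff_mul_pow_le d 1
  have h3 : ∑ h ∈ range (d + 1), (fejerCoeff d h * (-(h : ℝ))) ^ 2 = ∑ h ∈ range (d + 1), (fejerCoeff d h * (h : ℝ) ^ 1) ^ 2 :=
    Finset.sum_congr rfl fun h _ => by ring
  rw [h3] at h
  norm_num at h2 h
  nlinarith [Real.pi_pos]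

/-- `∫Φ₂² ≤ 8π(d+1)⁵`. -/
theorem integral_sq_fejerP2_le (d : ℕ) : ∫ s in (-π)..π, fejerP2 d s ^ 2 ≤ 8 * π * ((d : ℝ) + 1) ^ 5 := by
  have h := integral_sq_cosSum_le (d + 1) (fun h => fejerCoeff d h * (-(h : ℝ) ^ 2))
  have hf : ∀ s, ∑ h ∈ range (d + 1), fejerCoeff d h * (-(h : ℝ) ^ 2) * Real.cos (h * s) = fejerP2 d s := fun s => by
    unfold fejerP2; exact Finset.sum_congr rfl fun h _ => by ring
  simp_rw [hf] at h
  have h2 := sum_sq_fejerCoeff_mul_pow_le d 2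
  norm_num at h2
  have h3 : ∑ h ∈ range (d + 1), (fejerCoeff d h * (-(h : ℝ) ^ 2)) ^ 2 = ∑ h ∈ range (d + 1), (fejerCoeff d h * (h : ℝ) ^ 2) ^ 2 :=
    Finset.sum_congr rfl fun h _ => by ring
  rw [h3] at h
  nlinarith [Real.pi_pos]

/-- `∫Φ₃² ≤ 8π(d+1)⁷`. -/
theorem integral_sq_fejerP3_le (d : ℕ) : ∫ s in (-π)..π, fejerP3 d s ^ 2 ≤ 8 * π * ((d : ℝ) + 1) ^ 7 := by
  have h := integral_sq_sinSum_le (d + 1) (fun h => fejerCoeff d h * (h : ℝ) ^ 3)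
  have hf : ∀ s, ∑ h ∈ range (d + 1), fejerCoeff d h * (h : ℝ) ^ 3 * Real.sin (h * s) = fejerP3 d s := fun s => by
    unfold fejerP3; exact Finset.sum_congr rfl fun h _ => by ring
  simp_rw [hf] at h
  have h2 := sum_sq_fejerCoeff_mul_pow_le d 3
  norm_num at h2
  nlinarith [Real.pi_pos]

/-! ## §5 The `L¹` bounds -/

/-- Weighted AM–GM: `|x·y| ≤ (t·x² + y²/t)/2` for `t > 0`. -/
theorem abs_mul_le_amgm {t : ℝ} (ht : 0 < t) (x y : ℝ) : |x * y| ≤ (t * x ^ 2 + y ^ 2 / t) / 2 := by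
  rw [abs_mul]
  have hx := abs_nonneg x; have hy := abs_nonneg y
  have h1 : t * x ^ 2 = t * |x| ^ 2 := by rw [sq_abs]
  have h2 : y ^ 2 / t = |y| ^ 2 / t := by rw [sq_abs]
  rw [h1, h2]
  have key : 0 ≤ (t * |x| - |y|) ^ 2 / t := div_nonneg (sq_nonneg _) ht.le
  have e : (t * |x| ^ 2 + |y| ^ 2 / t) / 2 - |x| * |y| = (t * |x| - |y|) ^ 2 / t / 2 := by
    field_simp; ring
  linarith [e]

/-- `∫|fg| ≤ (t·∫f² + (∫g²)/t)/2` on `[−π,π]` for continuous `f, g` and `t > 0`. -/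
theorem integral_abs_mul_le_amgm {f g : ℝ → ℝ} (hf : Continuous f) (hg : Continuous g) {t : ℝ} (ht : 0 < t) :
    ∫ s in (-π)..π, |f s * g s| ≤ (t * (∫ s in (-π)..π, f s ^ 2) + (∫ s in (-π)..π, g s ^ 2) / t) / 2 := by
  have hππ : -π ≤ π := by linarith [Real.pi_pos]
  calc ∫ s in (-π)..π, |f s * g s| ≤ ∫ s in (-π)..π, (t * f s ^ 2 + g s ^ 2 / t) / 2 :=
        intervalIntegral.integral_mono_on hππ ((hf.mul hg).abs.intervalIntegrable _ _) (Continuous.intervalIntegrable (by fun_prop) _ _)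
          fun s _ => abs_mul_le_amgm ht _ _
    _ = (t * (∫ s in (-π)..π, f s ^ 2) + (∫ s in (-π)..π, g s ^ 2) / t) / 2 := by
        rw [intervalIntegral.integral_div, intervalIntegral.integral_add (Continuous.intervalIntegrable (by fun_prop) _ _)
          (Continuous.intervalIntegrable (by fun_prop) _ _), intervalIntegral.integral_const_mul, intervalIntegral.integral_div]

/-- The normalisation `2πc > 0`. -/
theorem jacksonNorm_pos (d : ℕ) : 0 < jacksonConst d * (2 * π) := mul_pos (jacksonConst_pos d) (by positivity)

/-- The coefficient step: `K/c ≤ (π⁴/(8(d+1)))·K` for `K ≥ 0`, i.e. `(2/(2πc))·(8π·X) = 8X/c ≤ π⁴ X/(d+1)`. -/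
theorem coef_le (d : ℕ) {X : ℝ} (hX : 0 ≤ X) :
    2 / (jacksonConst d * (2 * π)) * (8 * π * X) ≤ π ^ 4 * X / ((d : ℝ) + 1) := by
  have hc := jacksonConst_ge d
  have hcpos := jacksonConst_pos d
  have hd1 : (0 : ℝ) < (d : ℝ) + 1 := by positivity
  have hπ : (0 : ℝ) < π := Real.pi_pos
  have e1 : 2 / (jacksonConst d * (2 * π)) * (8 * π * X) = 8 * X / jacksonConst d := by
    field_simp
  rw [e1, div_le_div_iff₀ hcpos hd1]
  -- `8X(d+1) ≤ π⁴ X c` from `8(d+1)/π⁴ ≤ c`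
  have h2 := mul_le_mul_of_nonneg_left hc (by positivity : (0:ℝ) ≤ π ^ 4 * X)
  have e2 : π ^ 4 * X * (8 * ((d : ℝ) + 1) / π ^ 4) = 8 * X * ((d : ℝ) + 1) := by field_simp
  rw [e2] at h2
  linarith

/-- `∫|J̃_d| = 1`. -/
theorem integral_abs_jkerD_zero (d : ℕ) : ∫ s in (-π)..π, |jkerD d 0 s| = 1 := by
  rw [jkerD_zero]
  have : ∀ s, |jker d s| = jker d s := fun s => abs_of_nonneg (jker_nonneg d s)
  simp_rw [this]; exact integral_jker d

/-- **`∫|J̃_d′| ≤ π⁴(d+1)`.** -/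
theorem integral_abs_jkerD_one_le (d : ℕ) : ∫ s in (-π)..π, |jkerD d 1 s| ≤ π ^ 4 * ((d : ℝ) + 1) := by
  rw [jkerD_one]
  have hcpos := jacksonNorm_pos d
  have hd1 : (0 : ℝ) < (d : ℝ) + 1 := by positivity
  have habs : ∀ s, |jkerD1 d s| = (2 / (jacksonConst d * (2 * π))) * |fejerP d s * fejerP1 d s| := by
    intro s; unfold jkerD1
    rw [show 2 * fejerP d s * fejerP1 d s = 2 * (fejerP d s * fejerP1 d s) by ring, abs_div, abs_mul, abs_two,
      abs_of_pos hcpos]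
    ring
  simp_rw [habs]
  rw [intervalIntegral.integral_const_mul]
  have hI := integral_abs_mul_le_amgm (continuous_fejerP d) (continuous_fejerP1 d) hd1
  have hA := integral_sq_fejerP_le d
  have hB := integral_sq_fejerP1_le d
  have hI' : ∫ s in (-π)..π, |fejerP d s * fejerP1 d s| ≤ 8 * π * ((d : ℝ) + 1) ^ 2 := by
    have h1 : (∫ s in (-π)..π, fejerP1 d s ^ 2) / ((d : ℝ) + 1) ≤ 8 * π * ((d : ℝ) + 1) ^ 2 := by
      rw [div_le_iff₀ hd1]; nlinarith
    have h2 : ((d : ℝ) + 1) * (∫ s in (-π)..π, fejerP d s ^ 2) ≤ 8 * π * ((d : ℝ) + 1) ^ 2 := by nlinarith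
    linarith
  calc 2 / (jacksonConst d * (2 * π)) * ∫ s in (-π)..π, |fejerP d s * fejerP1 d s|
      ≤ 2 / (jacksonConst d * (2 * π)) * (8 * π * ((d : ℝ) + 1) ^ 2) :=
        mul_le_mul_of_nonneg_left hI' (div_nonneg (by norm_num) hcpos.le)
    _ ≤ π ^ 4 * ((d : ℝ) + 1) ^ 2 / ((d : ℝ) + 1) := coef_le d (by positivity)
    _ = π ^ 4 * ((d : ℝ) + 1) := by field_simp

/-- **`∫|J̃_d″| ≤ 2π⁴(d+1)²`.** -/
theorem integral_abs_jkerD_two_le (d : ℕ) : ∫ s in (-π)..π, |jkerD d 2 s| ≤ 2 * π ^ 4 * ((d : ℝ) + 1) ^ 2 := by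
  rw [jkerD_two]
  have hcpos := jacksonNorm_pos d
  have hd2 : (0 : ℝ) < ((d : ℝ) + 1) ^ 2 := by positivity
  have hππ : -π ≤ π := by linarith [Real.pi_pos]
  have hcoef : 0 ≤ 2 / (jacksonConst d * (2 * π)) := div_nonneg (by norm_num) hcpos.le
  have habs : ∀ s, |jkerD2 d s| ≤ (2 / (jacksonConst d * (2 * π))) * (fejerP1 d s ^ 2 + |fejerP d s * fejerP2 d s|) := by
    intro s; unfold jkerD2
    have e : |2 * (fejerP1 d s ^ 2 + fejerP d s * fejerP2 d s) / (jacksonConst d * (2 * π))| =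
        2 / (jacksonConst d * (2 * π)) * |fejerP1 d s ^ 2 + fejerP d s * fejerP2 d s| := by
      rw [abs_div, abs_mul, abs_two, abs_of_pos hcpos]; ring
    rw [e]
    refine mul_le_mul_of_nonneg_left ((abs_add_le _ _).trans ?_) hcoef
    rw [abs_of_nonneg (sq_nonneg _)]
  have hI := integral_abs_mul_le_amgm (continuous_fejerP d) (continuous_fejerP2 d) hd2
  have hA := integral_sq_fejerP_le d
  have hB := integral_sq_fejerP1_le d
  have hC := integral_sq_fejerP2_le d
  have hI' : ∫ s in (-π)..π, |fejerP d s * fejerP2 d s| ≤ 8 * π * ((d : ℝ) + 1) ^ 3 := by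
    have h1 : (∫ s in (-π)..π, fejerP2 d s ^ 2) / ((d : ℝ) + 1) ^ 2 ≤ 8 * π * ((d : ℝ) + 1) ^ 3 := by
      rw [div_le_iff₀ hd2]; nlinarith
    have h2 : ((d : ℝ) + 1) ^ 2 * (∫ s in (-π)..π, fejerP d s ^ 2) ≤ 8 * π * ((d : ℝ) + 1) ^ 3 := by nlinarith
    linarith
  have hcont : Continuous fun s => (2 / (jacksonConst d * (2 * π))) * (fejerP1 d s ^ 2 + |fejerP d s * fejerP2 d s|) :=
    continuous_const.mul (((continuous_fejerP1 d).pow 2).add ((continuous_fejerP d).mul (continuous_fejerP2 d)).abs)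
  calc ∫ s in (-π)..π, |jkerD2 d s|
      ≤ ∫ s in (-π)..π, (2 / (jacksonConst d * (2 * π))) * (fejerP1 d s ^ 2 + |fejerP d s * fejerP2 d s|) :=
        intervalIntegral.integral_mono_on hππ (((continuous_jkerD d 2).congr (fun s => by rw [jkerD_two])).abs.intervalIntegrable _ _)
          (hcont.intervalIntegrable _ _) fun s _ => habs s
    _ = (2 / (jacksonConst d * (2 * π))) * ((∫ s in (-π)..π, fejerP1 d s ^ 2) + ∫ s in (-π)..π, |fejerP d s * fejerP2 d s|) := by
        have hi1 : IntervalIntegrable (fun x => fejerP1 d x ^ 2) volume (-π) π := ((continuous_fejerP1 d).pow 2).intervalIntegrable _ _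
        have hi2 : IntervalIntegrable (fun x => |fejerP d x * fejerP2 d x|) volume (-π) π :=
          ((continuous_fejerP d).mul (continuous_fejerP2 d)).abs.intervalIntegrable _ _
        rw [intervalIntegral.integral_const_mul, intervalIntegral.integral_add hi1 hi2]
    _ ≤ (2 / (jacksonConst d * (2 * π))) * (8 * π * (2 * ((d : ℝ) + 1) ^ 3)) :=
        mul_le_mul_of_nonneg_left (by nlinarith) hcoef
    _ ≤ π ^ 4 * (2 * ((d : ℝ) + 1) ^ 3) / ((d : ℝ) + 1) := coef_le d (by positivity)
    _ = 2 * π ^ 4 * ((d : ℝ) + 1) ^ 2 := by field_simp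

/-- **`∫|J̃_d‴| ≤ 4π⁴(d+1)³`.** -/
theorem integral_abs_jkerD_three_le (d : ℕ) : ∫ s in (-π)..π, |jkerD d 3 s| ≤ 4 * π ^ 4 * ((d : ℝ) + 1) ^ 3 := by
  rw [jkerD_three]
  have hcpos := jacksonNorm_pos d
  have hd1 : (0 : ℝ) < (d : ℝ) + 1 := by positivity
  have hd3 : (0 : ℝ) < ((d : ℝ) + 1) ^ 3 := by positivity
  have hππ : -π ≤ π := by linarith [Real.pi_pos]
  have hcoef : 0 ≤ 2 / (jacksonConst d * (2 * π)) := div_nonneg (by norm_num) hcpos.le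
  have habs : ∀ s, |jkerD3 d s| ≤ (2 / (jacksonConst d * (2 * π))) * (3 * |fejerP1 d s * fejerP2 d s| + |fejerP d s * fejerP3 d s|) := by
    intro s; unfold jkerD3
    have e : |2 * (3 * fejerP1 d s * fejerP2 d s + fejerP d s * fejerP3 d s) / (jacksonConst d * (2 * π))| =
        2 / (jacksonConst d * (2 * π)) * |3 * fejerP1 d s * fejerP2 d s + fejerP d s * fejerP3 d s| := by
      rw [abs_div, abs_mul, abs_two, abs_of_pos hcpos]; ring
    rw [e]
    refine mul_le_mul_of_nonneg_left ((abs_add_le _ _).trans ?_) hcoef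
    rw [show 3 * fejerP1 d s * fejerP2 d s = 3 * (fejerP1 d s * fejerP2 d s) by ring, abs_mul,
      abs_of_pos (by norm_num : (0:ℝ) < 3)]
  have hI₁ := integral_abs_mul_le_amgm (continuous_fejerP1 d) (continuous_fejerP2 d) hd1
  have hI₂ := integral_abs_mul_le_amgm (continuous_fejerP d) (continuous_fejerP3 d) hd3
  have hA := integral_sq_fejerP_le d
  have hB := integral_sq_fejerP1_le d
  have hC := integral_sq_fejerP2_le d
  have hD := integral_sq_fejerP3_le d
  have hI₁' : ∫ s in (-π)..π, |fejerP1 d s * fejerP2 d s| ≤ 8 * π * ((d : ℝ) + 1) ^ 4 := by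
    have h1 : (∫ s in (-π)..π, fejerP2 d s ^ 2) / ((d : ℝ) + 1) ≤ 8 * π * ((d : ℝ) + 1) ^ 4 := by
      rw [div_le_iff₀ hd1]; nlinarith
    have h2 : ((d : ℝ) + 1) * (∫ s in (-π)..π, fejerP1 d s ^ 2) ≤ 8 * π * ((d : ℝ) + 1) ^ 4 := by nlinarith
    linarith
  have hI₂' : ∫ s in (-π)..π, |fejerP d s * fejerP3 d s| ≤ 8 * π * ((d : ℝ) + 1) ^ 4 := by
    have h1 : (∫ s in (-π)..π, fejerP3 d s ^ 2) / ((d : ℝ) + 1) ^ 3 ≤ 8 * π * ((d : ℝ) + 1) ^ 4 := by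
      rw [div_le_iff₀ hd3]; nlinarith
    have h2 : ((d : ℝ) + 1) ^ 3 * (∫ s in (-π)..π, fejerP d s ^ 2) ≤ 8 * π * ((d : ℝ) + 1) ^ 4 := by nlinarith
    linarith
  have hcont : Continuous fun s => (2 / (jacksonConst d * (2 * π))) * (3 * |fejerP1 d s * fejerP2 d s| + |fejerP d s * fejerP3 d s|) :=
    continuous_const.mul ((continuous_const.mul ((continuous_fejerP1 d).mul (continuous_fejerP2 d)).abs).add
      ((continuous_fejerP d).mul (continuous_fejerP3 d)).abs)
  calc ∫ s in (-π)..π, |jkerD3 d s|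
      ≤ ∫ s in (-π)..π, (2 / (jacksonConst d * (2 * π))) * (3 * |fejerP1 d s * fejerP2 d s| + |fejerP d s * fejerP3 d s|) :=
        intervalIntegral.integral_mono_on hππ (((continuous_jkerD d 3).congr (fun s => by rw [jkerD_three])).abs.intervalIntegrable _ _)
          (hcont.intervalIntegrable _ _) fun s _ => habs s
    _ = (2 / (jacksonConst d * (2 * π))) * (3 * (∫ s in (-π)..π, |fejerP1 d s * fejerP2 d s|) + ∫ s in (-π)..π, |fejerP d s * fejerP3 d s|) := by
        have hi1 : IntervalIntegrable (fun x => 3 * |fejerP1 d x * fejerP2 d x|) volume (-π) π :=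
          (continuous_const.mul ((continuous_fejerP1 d).mul (continuous_fejerP2 d)).abs).intervalIntegrable _ _
        have hi2 : IntervalIntegrable (fun x => |fejerP d x * fejerP3 d x|) volume (-π) π :=
          ((continuous_fejerP d).mul (continuous_fejerP3 d)).abs.intervalIntegrable _ _
        rw [intervalIntegral.integral_const_mul, intervalIntegral.integral_add hi1 hi2, intervalIntegral.integral_const_mul]
    _ ≤ (2 / (jacksonConst d * (2 * π))) * (8 * π * (4 * ((d : ℝ) + 1) ^ 4)) :=
        mul_le_mul_of_nonneg_left (by nlinarith) hcoef
    _ ≤ π ^ 4 * (4 * ((d : ℝ) + 1) ^ 4) / ((d : ℝ) + 1) := coef_le d (by positivity)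
    _ = 4 * π ^ 4 * ((d : ℝ) + 1) ^ 3 := by field_simp

/-- **THE `L¹` TABLE**: `∫|J̃_d^{(a)}| ≤ 4π⁴(d+1)^a` for `a ≤ 3` (uniform constant). -/
theorem integral_abs_jkerD_le (d : ℕ) {a : ℕ} (ha : a ≤ 3) : ∫ s in (-π)..π, |jkerD d a s| ≤ 4 * π ^ 4 * ((d : ℝ) + 1) ^ a := by
  have hπ4 : (1 : ℝ) ≤ π ^ 4 := one_le_pow₀ (by linarith [Real.pi_gt_three])
  have hd1 : (1 : ℝ) ≤ (d : ℝ) + 1 := by have := (Nat.cast_nonneg d : (0:ℝ) ≤ d); linarith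
  have hd0 : (0 : ℝ) < (d : ℝ) + 1 := by positivity
  interval_cases a
  · rw [integral_abs_jkerD_zero, pow_zero, mul_one]; linarith
  · refine (integral_abs_jkerD_one_le d).trans ?_; rw [pow_one]; nlinarith
  · refine (integral_abs_jkerD_two_le d).trans ?_; nlinarith [pow_pos hd0 2]
  · exact integral_abs_jkerD_three_le d

/-- **Products of two entries**: `(∫|J̃^{(a)}|)(∫|J̃^{(b)}|) ≤ 16π⁸(d+1)^{a+b}` for `a, b ≤ 3`. -/
theorem integral_abs_jkerD_mul_le (d : ℕ) {a b : ℕ} (ha : a ≤ 3) (hb : b ≤ 3) :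
    (∫ s in (-π)..π, |jkerD d a s|) * (∫ s in (-π)..π, |jkerD d b s|) ≤ 16 * π ^ 8 * ((d : ℝ) + 1) ^ (a + b) := by
  have h1 := integral_abs_jkerD_le d ha
  have h2 := integral_abs_jkerD_le d hb
  have hππ : -π ≤ π := by linarith [Real.pi_pos]
  have hn2 : 0 ≤ ∫ s in (-π)..π, |jkerD d b s| := intervalIntegral.integral_nonneg hππ fun s _ => abs_nonneg _
  calc (∫ s in (-π)..π, |jkerD d a s|) * (∫ s in (-π)..π, |jkerD d b s|)
      ≤ (4 * π ^ 4 * ((d : ℝ) + 1) ^ a) * (4 * π ^ 4 * ((d : ℝ) + 1) ^ b) := mul_le_mul h1 h2 hn2 (by positivity)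
    _ = 16 * π ^ 8 * ((d : ℝ) + 1) ^ (a + b) := by rw [pow_add]; ring

end Summit.HubbardSuperconductivity.HubbardSuperconductivity.Theorems.KLRegimeSplit

end
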